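import Literature.Computability.Cryptography.ChenQuantumLWEReadoutOrder

/-!
# Chen 2024 (withdrawn), Step 8 → Step 9: the read-out bound of (S) is ATTAINED on its dummy family

REPRODUCTION / ANALYSIS OF A CLAIMED RESULT UNDER ADJUDICATION — header required by the tree's literature
rule.  Author: Yilei Chen.  Title: *Quantum Algorithms for Lattice Problems*.  Venue: IACR Cryptology ePrint
Archive, Paper 2024/555, version of 18 April 2024 (the main claim WITHDRAWN by the author, title-page note;
the bug is in Step 9, p. 37). [ChenQuantumLattice2024]  Printed page numbers.

HONEST FRAMING (bundle `papers/QuantumAdvantage/lwe-quantum-autopsy/`, Part 1, generation 11, second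
module): the value of this file is a set of kernel-checked THEOREMS — the TIGHTNESS, on the averaging family,
of the programme's own upper bound (module (S) `ChenQuantumLWEReadoutOrder`) for one step of a withdrawn
algorithm — NOT summit progress and no cryptanalytic claim in either direction (nothing here says LWE is
quantumly easy or hard; no algorithm for LWE is proposed, repaired or broken; the §3.5.9 bug stands).

THE QUESTION.  (S) `Shape.step9Needs_readout_le_dummies` proved: for every POVM `E` on the Step-8 register
`|φ7.d⟩` and every decoder `dec` to `ℤ_{D²P}`, some instance of the class "tail slopes unknown on `T`" has
success weight for the Step-9 datum `step9Needs = v′₀ mod D²P` at most `pairsCountT(Q,T)/Q^{2n}·⟨φ7.d|φ7.d⟩`,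
`pairsCountT(Q,T) = #{(η,δ) ∈ ℤ_Qⁿ × ℤ_Qⁿ : Σ_{t∈T} η_tδ_t = 0}`, by averaging over the family
`F_T = {(famBT T β, v′ + L·(x, ȳ)) : β, ȳ ∈ ℤ_Qⁿ, x ∈ ℤ_Q}`; and (S) `Shape.blindGuess_weight_eq` proved that
blind guessing achieves `(1/Q)·⟨φ7.d|φ7.d⟩` on every instance.  (S) SCOPE (a) left open whether the upper
constant is attained.  This file proves it IS, on every member of `F_T`, by an explicit measurement.

WHAT IS DONE HERE.  Fix an admissible shape `S` and a finite set `T` of tail coordinates.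
* **`POVM.ofFrame`** (general): for ANY family `(w_j)_j` of pairwise orthogonal vectors of common squared
  norm `ν > 0` on a finite register, `{|w_j⟩⟨w_j|/ν}_j ∪ {1 − Σ_j |w_j⟩⟨w_j|/ν}` is a POVM ((O) `POVM`, (Q)
  `projEffect`) — positivity of the complement is Bessel's inequality **`POVM.bessel_frame`**; weights
  `‖⟨w_j|φ⟩‖²/ν` (`POVM.ofFrame_weight_some`) and the deficit on `none` (`POVM.ofFrame_weight_none_re`).
* **`Shape.star_wv_dotProduct_wv'`** — (R)'s FRAME IS ORTHOGONAL: `⟨w_{η,m}|w_{η′,m′}⟩ = P·2ⁿ·Qⁿ·[(η,m) =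
  (η′,m′)]` (the cross sum factors into the character sums `Σ_{y∈ℤ_Qⁿ} ψ_Q(⟨η′−η,y⟩)` and
  `Σ_{i<P} ψ_Q((m′−m)i)`, `P = p₁Q`: `sum_range_P_stdAddChar_mul`); hence the TRANSFORMED FRAME
  `W_{η,m} := T w_{η,m}` (`Shape.frameVec`, `T` = Step 8 (ii)–(v), (R) `step8Map`) is orthogonal with common
  squared norm `ν = (MD)ⁿ⁺¹·P·2ⁿ·Qⁿ` (**`Shape.frame_orth`**, via (R) `dotProduct_step8Map`, `wv_support_D`).
* **`Shape.phi7d_member_apply`**, **`Shape.frameVec_dotProduct_member`** — every member of `F_T` is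
  `|φ7.d⟩ = Σ_η coef(η)·W_{η, m(η)}` with `‖coef(η)‖ = Q⁻ⁿ` (`norm_coefOf`) and block datum
  `m(η) = −2(x + σ₀(η) + Σ_{t∈T} η_tβ_t)` (`Shape.mOf`; (R) `phi7_inst_expansion`, (S) `sig_BfamT`), so
  `⟨W_{η′,m′}|φ7.d⟩ = coef(η′)·ν·[m′ = m(η′)]`.
* **`Shape.framePOVM`**, **`Shape.frameDec`** — the frame POVM of `(W_{η,m})` followed by a uniform guess
  `β′ ∈ ℤ_Qⁿ` of the dummies ((S) `POVM.withCoin`) and the decoder `((η,m), β′) ↦ v′₀ + L·x̂ (mod D²P)`,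
  `x̂ = −m/2 − σ₀(η) − Σ_{t∈T} η_tβ′_t` (`Shape.xhat`; `Q` odd).  On a member: outcome `(some (η′,m′), β′)`
  has weight `ν/Q^{3n}·[m′ = m(η′)]` (`Shape.frame_weight_some_re` with the coin factor `Q⁻ⁿ`), outcome
  `none` has weight `0` (`Shape.frame_weight_none_re`: members lie in the span of the frame), and the
  decoding is right iff `Σ_{t∈T} η′_t(β_t − β′_t) = 0` (`Shape.frameDec_correct_iff`, (R) `label_inj`);
  the right outcomes are counted by `pairsCountT` (`Shape.card_correct_eq_pairsCountT`).
* **`Shape.step9Needs_readout_attained`** — on EVERY member of `F_T` the success weight of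
  `framePOVM` + `frameDec T` is EXACTLY `pairsCountT(Q,T)/Q^{2n}·⟨φ7.d|φ7.d⟩`, the constant of (S).
* **`pow_lt_mul_pairsCountT`** (`Q^{2n} < Q·pairsCountT(Q,T)` for odd `Q > 1`, from (S)
  `card_fibre_le_kerCountT`: every kernel has `≥ Q^{n−1}` elements) and
  **`Shape.blindGuess_lt_readout_attained`** — that weight is STRICTLY larger than the blind-guess weight
  `(1/Q)·⟨φ7.d|φ7.d⟩`: on `F_T` the two sides of (S)'s order are different numbers and the upper one is
  the truth.  **`Shape.step9Needs_readout_value_family`** packages (S)'s bound with its attainment.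
* **`Shape.mul_pairsCountT_eq_prime`**, **`Shape.pairsCountT_div_eq_prime`** — for a PRIME `Q` the count is
  exact: `Q·pairsCountT(Q,T) = Qⁿ(Qⁿ + (Q − 1)Q^{n−#T})`, i.e. `pairsCountT/Q^{2n} = 1/Q + (1 − 1/Q)/Q^{#T}`
  ((S)'s `mul_pairsCountT_le` is an equality when every nonzero residue is a unit: slope vectors vanishing
  on `T` have kernel `ℤ_Qⁿ`, `kerCountT_of_forall_eq_zero`; all others have a kernel of exactly `Q^{n−1}`
  points, `mul_kerCountT_of_isUnit`); hence **`Shape.step9Needs_readout_attained_prime`**: the constant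
  `1/Q + (1 − 1/Q)/Q^{#T}` of (S) `Shape.step9Needs_readout_le_dummies_prime` is itself attained on every
  member of `F_T`.

SCOPE (honest).  (a) Decided: the minimax value of the single-copy read-out problem ON THE FAMILY `F_T` is
`pairsCountT(Q,T)/Q^{2n}`, attained on every member and strictly above `1/Q`; for prime `Q` it equals
`1/Q + (1 − 1/Q)/Q^{#T}` (`Shape.pairsCountT_div_eq_prime`), for composite odd `Q` the number `pairsCountT`
is not evaluated here (only (S)'s estimate `≤ 1/Q + (1 − 1/Q)·((Q − φ(Q))/Q)^{#T}`).  NOT decided and not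
claimed: the optimal worst-case
value over the WHOLE class `InClass U` (all offsets `v′`, in particular other cosets `v′ mod L`, and all
slopes), which lies in `[1/Q, pairsCountT(Q,T′)/Q^{2n}]` for the largest admissible `T′`; instances whose
tail offsets differ by `L/2` share frame points ((O) `dot_phi7d_ne_zero_moveT`), so the frames of different
cosets are not mutually orthogonal and no single measurement of the present kind serves them all — whether
some measurement does is open here.  (b) The family, the frame and the measurement are proof devices about
the state `|φ7.d⟩` of eq. (35)/§3.5.8 as formalised in `ChenQuantumLWESteps` / `ChenQuantumLWEStepEight`,
one run, one copy; `framePOVM` is a mathematical POVM (a positive-operator family summing to `1`), no circuit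
or complexity statement is made or needed.  (c) Nothing here bears on LWE: reading out the datum with the
probability above on this family neither repairs Step 9 (the paper's own bug note, p. 37, and Part 1 (A)–(D)
stand) nor says anything about other algorithms.  (d) No numerics enter any proof.

Everything is `sorry`-free over Mathlib and modules (A)–(S) of the bundle (imported, nothing re-proved).
-/

namespace Literature.Computability.Cryptography.Chen2024

open Matrix ComplexOrder

namespace POVM

section Frame

variable {X ι : Type*} [Fintype X] [DecidableEq X] [Fintype ι] [DecidableEq ι]

omit [DecidableEq X] in
/-- **Bessel's inequality for an orthogonal frame of common squared norm `ν`:**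
`Σ_j ‖⟨w_j|x⟩‖² ≤ ν·⟨x|x⟩`. [folklore] -/
theorem bessel_frame (w : ι → X → ℂ) {ν : ℝ} (hν : 0 < ν)
    (horth : ∀ j k, star (w j) ⬝ᵥ w k = if j = k then ((ν : ℝ) : ℂ) else 0) (x : X → ℂ) :
    ∑ j, ‖star (w j) ⬝ᵥ x‖ ^ 2 ≤ ν * (star x ⬝ᵥ x).re := by
  -- the coefficients and the projection
  set a : ι → ℂ := fun j => star (w j) ⬝ᵥ x with ha
  set p : X → ℂ := ∑ j, (((ν⁻¹ : ℝ) : ℂ) * a j) • w j with hp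
  -- `⟨w_k|p⟩ = a_k`
  have h1 : ∀ k, star (w k) ⬝ᵥ p = a k := by
    intro k
    rw [hp, dotProduct_sum]
    simp_rw [dotProduct_smul, smul_eq_mul, horth k]
    rw [Finset.sum_eq_single k (fun j _ hj => by rw [if_neg (Ne.symm hj), mul_zero])
      (fun hk => absurd (Finset.mem_univ k) hk), if_pos rfl]
    have hν0 : ((ν : ℝ) : ℂ) ≠ 0 := Complex.ofReal_ne_zero.2 hν.ne'
    push_cast
    rw [mul_comm, ← mul_assoc, mul_inv_cancel₀ hν0, one_mul]
  -- `Σ_k |a_k|²` as a complex number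
  have hsq : ∀ k, (starRingEnd ℂ) (a k) * a k = (((‖a k‖ ^ 2 : ℝ)) : ℂ) := by
    intro k
    rw [Complex.conj_mul']
    push_cast
    ring
  -- `⟨p|y⟩ = Σ_k conj(ν⁻¹ a_k) ⟨w_k|y⟩`
  have hpy : ∀ y : X → ℂ, star p ⬝ᵥ y = ∑ k, (starRingEnd ℂ) (((ν⁻¹ : ℝ) : ℂ) * a k) * (star (w k) ⬝ᵥ y) := by
    intro y
    rw [hp, star_sum, sum_dotProduct]
    refine Finset.sum_congr rfl fun k _ => ?_
    rw [star_smul, smul_dotProduct, smul_eq_mul, Complex.star_def]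
  -- `⟨p|p⟩ = ν⁻¹ Σ |a_k|²` and `⟨p|x⟩ = ν⁻¹ Σ |a_k|²`
  have hB : (((ν⁻¹ * ∑ k, ‖a k‖ ^ 2 : ℝ)) : ℂ)
      = ∑ k, (starRingEnd ℂ) (((ν⁻¹ : ℝ) : ℂ) * a k) * a k := by
    push_cast
    rw [Finset.mul_sum]
    refine Finset.sum_congr rfl fun k _ => ?_
    rw [map_mul, mul_assoc, hsq, map_inv₀, Complex.conj_ofReal]
    push_cast
    ring
  have hpp : star p ⬝ᵥ p = (((ν⁻¹ * ∑ k, ‖a k‖ ^ 2 : ℝ)) : ℂ) := by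
    rw [hpy, hB]
    simp_rw [h1]
  have hpx : star p ⬝ᵥ x = (((ν⁻¹ * ∑ k, ‖a k‖ ^ 2 : ℝ)) : ℂ) := by
    rw [hpy, hB]
  have hxp : star x ⬝ᵥ p = (((ν⁻¹ * ∑ k, ‖a k‖ ^ 2 : ℝ)) : ℂ) := by
    rw [star_dotProduct_comm_conj, hpx, Complex.conj_ofReal]
  -- `0 ≤ ⟨x - p|x - p⟩ = ⟨x|x⟩ - ν⁻¹ Σ |a_k|²`
  have hnn := star_dotProduct_self_re_nonneg (x - p)
  rw [star_sub, sub_dotProduct, dotProduct_sub, dotProduct_sub, hxp, hpx, hpp] at hnn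
  simp only [Complex.sub_re, Complex.ofReal_re, sub_self, sub_zero] at hnn
  rw [sub_nonneg, inv_mul_le_iff₀ hν] at hnn
  exact hnn

omit [DecidableEq X] [DecidableEq ι] in
/-- The frame projector `Σ_j |w_j⟩⟨w_j|/⟨w_j|w_j⟩` is Hermitian. [cite: NielsenChuang2010, §2.2.6 p. 90] -/
theorem isHermitian_sum_projEffect (w : ι → X → ℂ) : (∑ j, projEffect (w j)).IsHermitian := by
  show (_ : Matrix X X ℂ)ᴴ = _
  rw [Matrix.conjTranspose_sum]
  exact Finset.sum_congr rfl fun j _ => (isHermitian_projEffect (w j)).eq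

/-- For an orthogonal frame of common squared norm `ν > 0`, `1 − Σ_j |w_j⟩⟨w_j|/ν ≥ 0` (Bessel).
[cite: NielsenChuang2010, §2.2.6 p. 90] -/
theorem posSemidef_one_sub_sum_projEffect (w : ι → X → ℂ) {ν : ℝ} (hν : 0 < ν)
    (horth : ∀ j k, star (w j) ⬝ᵥ w k = if j = k then ((ν : ℝ) : ℂ) else 0) :
    (1 - ∑ j, projEffect (w j)).PosSemidef := by
  refine Matrix.PosSemidef.of_dotProduct_mulVec_nonneg
    (Matrix.isHermitian_one.sub (isHermitian_sum_projEffect w)) fun x => ?_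
  have hnorm : ∀ j, (star (w j) ⬝ᵥ w j).re = ν := by
    intro j
    rw [horth j j, if_pos rfl, Complex.ofReal_re]
  rw [Matrix.sub_mulVec, Matrix.one_mulVec, dotProduct_sub, Matrix.sum_mulVec, dotProduct_sum]
  simp_rw [dotProduct_projEffect_mulVec_self, hnorm]
  rw [star_dotProduct_self_eq_re x, ← Complex.ofReal_sum, ← Complex.ofReal_sub]
  refine Complex.zero_le_real.2 (sub_nonneg.2 ?_)
  rw [← Finset.mul_sum, inv_mul_le_iff₀ hν]
  exact bessel_frame w hν horth x

/-- **The frame measurement:** for an orthogonal frame `(w_j)_j` of common squared norm `ν > 0`,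
outcome `some j` with effect `|w_j⟩⟨w_j|/ν` and outcome `none` with the complementary effect
`1 − Σ_j |w_j⟩⟨w_j|/ν`. [cite: NielsenChuang2010, §2.2.6 p. 90] -/
noncomputable def ofFrame (w : ι → X → ℂ) {ν : ℝ} (hν : 0 < ν)
    (horth : ∀ j k, star (w j) ⬝ᵥ w k = if j = k then ((ν : ℝ) : ℂ) else 0) : POVM X (Option ι) where
  effect := fun o => match o with
    | some j => projEffect (w j)
    | none => 1 - ∑ j, projEffect (w j)
  posSemidef := fun o => by
    cases o with
    | some j => exact posSemidef_projEffect (w j)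
    | none => exact posSemidef_one_sub_sum_projEffect w hν horth
  sum_eq_one := by
    rw [Fintype.sum_option]
    exact sub_add_cancel 1 _

/-- Weight of outcome `some j` on `φ`: `‖⟨w_j|φ⟩‖²/ν`. [cite: NielsenChuang2010, §2.2.6 p. 90] -/
theorem ofFrame_weight_some (w : ι → X → ℂ) {ν : ℝ} (hν : 0 < ν)
    (horth : ∀ j k, star (w j) ⬝ᵥ w k = if j = k then ((ν : ℝ) : ℂ) else 0) (φ : X → ℂ) (j : ι) :
    (ofFrame w hν horth).weight φ (some j) = (((ν⁻¹ * ‖star (w j) ⬝ᵥ φ‖ ^ 2 : ℝ)) : ℂ) := by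
  show star φ ⬝ᵥ (projEffect (w j) *ᵥ φ) = _
  rw [dotProduct_projEffect_mulVec_self, horth j j, if_pos rfl, Complex.ofReal_re]

/-- The `none` outcome carries the deficit: `⟨φ|φ⟩ − Σ_j ‖⟨w_j|φ⟩‖²/ν`. [cite: NielsenChuang2010, §2.2.6 p. 90] -/
theorem ofFrame_weight_none_re (w : ι → X → ℂ) {ν : ℝ} (hν : 0 < ν)
    (horth : ∀ j k, star (w j) ⬝ᵥ w k = if j = k then ((ν : ℝ) : ℂ) else 0) (φ : X → ℂ) :
    ((ofFrame w hν horth).weight φ none).re = (star φ ⬝ᵥ φ).re - ∑ j, ν⁻¹ * ‖star (w j) ⬝ᵥ φ‖ ^ 2 := by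
  have h := (ofFrame w hν horth).sum_weight_re φ
  rw [Fintype.sum_option] at h
  simp_rw [ofFrame_weight_some, Complex.ofReal_re] at h
  linarith

end Frame

end POVM

/-- **Cross inner product of two point sums on the same distinct points:** `⟨w|w′⟩ = Σ_a conj(c_a)·c′_a`.
[folklore] -/
theorem star_pointSum_dotProduct_pointSum {X ι : Type*} [Fintype X] [DecidableEq X] [DecidableEq ι]
    (s : Finset ι) (pt : ι → X) (c c' : ι → ℂ) (hinj : Set.InjOn pt s) (w w' : X → ℂ)
    (hw : ∀ z, w z = ∑ a ∈ s, if z = pt a then c a else 0)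
    (hw' : ∀ z, w' z = ∑ a ∈ s, if z = pt a then c' a else 0) :
    star w ⬝ᵥ w' = ∑ a ∈ s, (starRingEnd ℂ) (c a) * c' a := by
  have hpt : ∀ (d : ι → ℂ) (u : X → ℂ), (∀ z, u z = ∑ a ∈ s, if z = pt a then d a else 0) →
      ∀ a ∈ s, u (pt a) = d a := by
    intro d u hu a ha
    rw [hu, Finset.sum_eq_single_of_mem a ha]
    · rw [if_pos rfl]
    · intro b hb hba
      rw [if_neg]
      intro hab
      exact hba (hinj hb ha hab.symm)
  have hzero : ∀ z, z ∉ s.image pt → w' z = 0 := by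
    intro z hz
    rw [hw']
    refine Finset.sum_eq_zero fun a ha => ?_
    rw [if_neg]
    rintro rfl
    exact hz (Finset.mem_image_of_mem pt ha)
  simp only [dotProduct, Pi.star_apply, Complex.star_def]
  rw [← Finset.sum_subset (Finset.subset_univ (s.image pt))
    (fun z _ hz => by rw [hzero z hz, mul_zero]), Finset.sum_image hinj]
  exact Finset.sum_congr rfl fun a ha => by rw [hpt c w hw a ha, hpt c' w' hw' a ha]

/-- A `Q`-periodic sum over `[0, a·Q)` is `a` copies of the sum over `ℤ_Q`. [folklore] -/
theorem sum_range_mul_eq_mul_sum {Q : ℕ} [NeZero Q] (g : ZMod Q → ℂ) (a : ℕ) :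
    ∑ i ∈ Finset.range (a * Q), g (i : ZMod Q) = (a : ℂ) * ∑ j : ZMod Q, g j := by
  induction a with
  | zero => simp
  | succ a ih =>
    rw [Nat.succ_mul, Finset.sum_range_add, ih, ← sum_range_eq_sum_zmod Q g]
    have hper : ∀ x : ℕ, g (((a * Q + x : ℕ)) : ZMod Q) = g ((x : ℕ) : ZMod Q) := by
      intro x
      congr 1
      push_cast
      rw [ZMod.natCast_self, mul_zero, zero_add]
    simp_rw [hper]
    rw [sum_range_eq_sum_zmod Q g]
    push_cast
    ring

/-- `Σ_{j ∈ ℤ_Q} ψ_Q(d·j) = Q·[d = 0]`. [folklore] -/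
theorem sum_stdAddChar_mul_eq {Q : ℕ} [NeZero Q] (d : ZMod Q) :
    ∑ j : ZMod Q, ZMod.stdAddChar (d * j) = if d = 0 then ((Q : ℂ)) else 0 := by
  have h := AddChar.sum_mulShift d (ZMod.isPrimitive_stdAddChar Q)
  rw [Nat.cast_ite, Nat.cast_zero, ZMod.card] at h
  rw [← h]
  exact Finset.sum_congr rfl fun j _ => by rw [mul_comm]

namespace Shape

variable (S : Shape)

/-- `(P : ℕ) = p₁·Q`. [cite: ChenQuantumLattice2024, §3.1 p. 22] -/
theorem P_coe_nat : ((S.P : ℕ)) = (S.p₁ : ℕ) * (S.Q : ℕ) := by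
  have h := S.P_coe
  exact_mod_cast h

/-- `Σ_{i<P} ψ_Q(d·i) = P·[d = 0]` (`P = p₁Q`, the phase is `Q`-periodic in `i`). [folklore] -/
theorem sum_range_P_stdAddChar_mul (d : ZMod S.Q) :
    ∑ i ∈ Finset.range (S.P : ℕ), ZMod.stdAddChar (d * (i : ZMod S.Q))
      = if d = 0 then (((S.P : ℕ)) : ℂ) else 0 := by
  rw [S.P_coe_nat, sum_range_mul_eq_mul_sum (fun j : ZMod S.Q => ZMod.stdAddChar (d * j)) (S.p₁ : ℕ),
    sum_stdAddChar_mul_eq]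
  split_ifs <;> push_cast <;> ring

/-- **THE FRAME IS ORTHOGONAL:** `⟨w_{η,m}|w_{η′,m′}⟩ = P·2ⁿ·Qⁿ·[(η,m) = (η′,m′)]` — the cross sum is
`2ⁿ · (Σ_{i<P} ψ_Q((m′−m)i)) · (Σ_y ψ_Q(⟨η′−η,y⟩))`, a product of two character sums. [folklore] -/
theorem star_wv_dotProduct_wv' (h : S.Admissible) (η η' : Fin S.n → ZMod S.Q) (m m' : ZMod S.Q) :
    star (S.wv η m) ⬝ᵥ S.wv η' m'
      = if η = η' ∧ m = m' then ((S.P : ℕ) : ℂ) * 2 ^ S.n * ((S.Q : ℕ) : ℂ) ^ S.n else 0 := by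
  classical
  by_cases heq : η = η' ∧ m = m'
  · rw [if_pos heq, ← heq.1, ← heq.2]
    exact S.star_wv_dotProduct_wv h η m
  rw [if_neg heq]
  set s : Finset (ℕ × (Fin S.n → Fin 2) × (Fin S.n → ZMod S.Q)) :=
    (Finset.range (S.P : ℕ)) ×ˢ ((Finset.univ : Finset (Fin S.n → Fin 2)) ×ˢ
      (Finset.univ : Finset (Fin S.n → ZMod S.Q))) with hs
  have hinj : Set.InjOn (fun a : ℕ × (Fin S.n → Fin 2) × (Fin S.n → ZMod S.Q) => S.wpt a.1 a.2.1 a.2.2)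
      ↑s := by
    intro a ha a' ha' hpt
    have hi : a.1 < (S.P : ℕ) := Finset.mem_range.1 (Finset.mem_product.1 (Finset.mem_coe.1 ha)).1
    have hi' : a'.1 < (S.P : ℕ) := Finset.mem_range.1 (Finset.mem_product.1 (Finset.mem_coe.1 ha')).1
    obtain ⟨h1, h2, h3⟩ := S.wpt_inj h hi hi' hpt
    exact Prod.ext h1 (Prod.ext h2 h3)
  rw [star_pointSum_dotProduct_pointSum s _
    (fun a => S.amp7 a.1 a.2.1 * ZMod.stdAddChar (m * (a.1 : ZMod S.Q) + ∑ t, η t * a.2.2 t))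
    (fun a => S.amp7 a.1 a.2.1 * ZMod.stdAddChar (m' * (a.1 : ZMod S.Q) + ∑ t, η' t * a.2.2 t))
    hinj (S.wv η m) (S.wv η' m') (S.wv_eq_pointSum η m) (S.wv_eq_pointSum η' m')]
  -- the summand is one character value
  have hterm : ∀ a : ℕ × (Fin S.n → Fin 2) × (Fin S.n → ZMod S.Q),
      (starRingEnd ℂ) (S.amp7 a.1 a.2.1 * ZMod.stdAddChar (m * (a.1 : ZMod S.Q) + ∑ t, η t * a.2.2 t))
        * (S.amp7 a.1 a.2.1 * ZMod.stdAddChar (m' * (a.1 : ZMod S.Q) + ∑ t, η' t * a.2.2 t))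
      = ZMod.stdAddChar ((m' - m) * (a.1 : ZMod S.Q)) * ZMod.stdAddChar (∑ t, (η' - η) t * a.2.2 t) := by
    intro a
    rw [map_mul, mul_mul_mul_comm, S.conj_amp7_mul_self, one_mul, ← AddChar.map_neg_eq_conj,
      ← AddChar.map_add_eq_mul, ← AddChar.map_add_eq_mul]
    congr 1
    simp only [Pi.sub_apply, sub_mul, Finset.sum_sub_distrib]
    ring
  simp_rw [hterm]
  rw [hs, Finset.sum_product]
  simp_rw [Finset.sum_product]
  simp_rw [← Finset.mul_sum, sum_stdAddChar_linForm (η' - η), ← Finset.sum_mul,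
    S.sum_range_P_stdAddChar_mul]
  by_cases hη : η = η'
  · have hm : m' - m ≠ 0 := fun h0 => heq ⟨hη, (sub_eq_zero.1 h0).symm⟩
    rw [if_neg hm, zero_mul]
  · have hne : η' - η ≠ 0 := fun h0 => hη (sub_eq_zero.1 h0).symm
    rw [if_neg hne, Finset.sum_const_zero, mul_zero]


/-! ### The transformed frame `W_{η,m} := T w_{η,m}` and its measurement -/

/-- The frame index set `ℤ_Qⁿ × ℤ_Q` (`(η, m)`). [folklore] -/
abbrev FrameIdx : Type := (Fin S.n → ZMod S.Q) × ZMod S.Q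

/-- The common squared norm of the transformed frame vectors: `ν := (MD)ⁿ⁺¹·P·2ⁿ·Qⁿ`. [folklore] -/
noncomputable def frameNormSq : ℝ :=
  (((S.M : ℕ) : ℝ) * (S.D : ℕ)) ^ (S.n + 1) * (((S.P : ℕ) : ℝ) * 2 ^ S.n * ((S.Q : ℕ) : ℝ) ^ S.n)

/-- `ν > 0`. [folklore] -/
theorem frameNormSq_pos : 0 < S.frameNormSq := by
  unfold frameNormSq
  have hM : (0 : ℝ) < (S.M : ℕ) := by exact_mod_cast S.M.pos
  have hD : (0 : ℝ) < (S.D : ℕ) := by exact_mod_cast S.D.pos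
  have hP : (0 : ℝ) < (S.P : ℕ) := by exact_mod_cast S.P.pos
  have hQ : (0 : ℝ) < (S.Q : ℕ) := by exact_mod_cast S.Q.pos
  positivity

/-- The TRANSFORMED FRAME VECTOR `W_{η,m} := T w_{η,m}` (Step 8 (ii)–(v) applied to the frame vector).
[cite: ChenQuantumLattice2024, §3.5.8 p. 33] -/
noncomputable def frameVec (j : S.FrameIdx) : Ket (S.n + 1) S.M := S.step8Map (S.wv j.1 j.2)

/-- **The transformed frame is orthogonal with common squared norm `ν`:** `⟨W_j|W_k⟩ = ν·[j = k]`
(`T` is `(MD)^{(n+1)/2}` times an isometry on `Dℤⁿ⁺¹`-supported kets). [folklore] -/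
theorem frame_orth (h : S.Admissible) (j k : S.FrameIdx) :
    star (S.frameVec j) ⬝ᵥ S.frameVec k = if j = k then ((S.frameNormSq : ℝ) : ℂ) else 0 := by
  unfold frameVec
  rw [S.dotProduct_step8Map _ _ (fun z hz => S.wv_support_D h hz), S.star_wv_dotProduct_wv' h]
  by_cases hjk : j = k
  · subst hjk
    rw [if_pos ⟨rfl, rfl⟩, if_pos rfl, frameNormSq]
    push_cast
    ring
  · have hne : ¬ (j.1 = k.1 ∧ j.2 = k.2) := fun h2 => hjk (Prod.ext h2.1 h2.2)
    rw [if_neg hne, if_neg hjk, mul_zero]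

/-- **THE FRAME MEASUREMENT of the Step-8 register** (outcomes `(some (η,m) | none, β′)`): the frame POVM of
`(W_{η,m})` followed by a uniformly random dummy guess `β′ ∈ ℤ_Qⁿ` (a classical coin, `POVM.withCoin`).
[cite: NielsenChuang2010, §2.2.6 p. 90] -/
noncomputable def framePOVM (h : S.Admissible) :
    POVM (Fin (S.n + 1) → ZMod S.M) (Option S.FrameIdx × (Fin S.n → ZMod S.Q)) :=
  (POVM.ofFrame S.frameVec S.frameNormSq_pos (S.frame_orth h)).withCoin (Fin S.n → ZMod S.Q)

/-! ### The members of the dummy family in the transformed frame -/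

/-- The head datum of block `η` for the member `(β, x)`: `m_{β,x}(η) := −2(x + σ_{B_T(β)}(η))`.
[cite: ChenQuantumLattice2024, eq. (35) p. 31] -/
def mOf (T : Finset (Fin S.n)) (β : Fin S.n → ZMod S.Q) (x : ZMod S.Q) (η : Fin S.n → ZMod S.Q) : ZMod S.Q :=
  -2 * (x + S.sig (S.BfamT T β) η)

/-- The coefficient of `W_{η, m(η)}` in `|φ7.d⟩` of the member `(β, x, ȳ)`:
`Q⁻ⁿ·ψ_Q(−⟨η,ȳ⟩)·ψ_Q(−2p₁xσ(η) − p₁x²)`. [cite: ChenQuantumLattice2024, eq. (35) p. 31, §3.5.8 p. 34] -/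
noncomputable def coefOf (T : Finset (Fin S.n)) (β : Fin S.n → ZMod S.Q) (x : ZMod S.Q)
    (yb η : Fin S.n → ZMod S.Q) : ℂ :=
  (1 / ((S.Q : ℕ) : ℂ) ^ S.n) * (ZMod.stdAddChar (-(∑ t, η t * yb t))
    * ZMod.stdAddChar (-(2 * ((S.p₁ : ℕ) : ZMod S.Q) * x * S.sig (S.BfamT T β) η) - ((S.p₁ : ℕ) : ZMod S.Q) * x ^ 2))

/-- **`|φ7.d⟩` of a member in the transformed frame:** `|φ7.d⟩_{β,x,ȳ} = Σ_η coef(η)·W_{η, m_{β,x}(η)}`.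
[cite: ChenQuantumLattice2024, eq. (35) p. 31, §3.5.8 pp. 33–34] -/
theorem phi7d_member_apply (T : Finset (Fin S.n)) (β : Fin S.n → ZMod S.Q) (x : ZMod S.Q)
    (yb : Fin S.n → ZMod S.Q) (p : Fin (S.n + 1) → ZMod S.M) :
    (S.inst (S.famBT T β) (S.vOf (S.xyv x yb))).phi7d p
      = ∑ η : Fin S.n → ZMod S.Q, S.coefOf T β x yb η * S.frameVec (η, S.mOf T β x η) p := by
  rw [phi7d_inst_eq_step8Map, S.step8Map_linComb Finset.univ (fun η => S.coefOf T β x yb η)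
    (fun η => S.wv η (S.mOf T β x η)) _ (fun z => ?_) p]
  · rfl
  · rw [S.phi7_inst_expansion (S.BfamT T β) (S.famBT_zero T β) (S.famBT_succ T β) x yb z, Finset.mul_sum]
    refine Finset.sum_congr rfl fun η _ => ?_
    rw [coefOf, mOf, ← AddChar.map_add_eq_mul, show -(∑ t, η t * yb t)
        + (-(2 * ((S.p₁ : ℕ) : ZMod S.Q) * x * S.sig (S.BfamT T β) η) - ((S.p₁ : ℕ) : ZMod S.Q) * x ^ 2)
        = -(∑ t, η t * yb t) - 2 * ((S.p₁ : ℕ) : ZMod S.Q) * x * S.sig (S.BfamT T β) η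
          - ((S.p₁ : ℕ) : ZMod S.Q) * x ^ 2 by ring]
    ring

/-- `‖coef(η)‖ = Q⁻ⁿ`. [folklore] -/
theorem norm_coefOf (T : Finset (Fin S.n)) (β : Fin S.n → ZMod S.Q) (x : ZMod S.Q)
    (yb η : Fin S.n → ZMod S.Q) : ‖S.coefOf T β x yb η‖ = 1 / ((S.Q : ℕ) : ℝ) ^ S.n := by
  -- `‖ψ_Q(a)‖ = 1` (`Literature.NumberTheory.LFunctions.norm_stdAddChar`, inlined to keep the import chain)
  have hψ : ∀ a : ZMod S.Q, ‖(ZMod.stdAddChar a : ℂ)‖ = 1 := fun a => by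
    rw [ZMod.stdAddChar_apply, Circle.norm_coe]
  unfold coefOf
  rw [norm_mul, norm_mul, hψ, hψ, mul_one, mul_one, norm_div, norm_one, norm_pow, Complex.norm_natCast]

/-- **Overlap of a frame vector with a member:** `⟨W_{η′,m′}|φ7.d_{β,x,ȳ}⟩ = coef(η′)·ν·[m′ = m_{β,x}(η′)]`.
[folklore] -/
theorem frameVec_dotProduct_member (h : S.Admissible) (T : Finset (Fin S.n)) (β : Fin S.n → ZMod S.Q)
    (x : ZMod S.Q) (yb : Fin S.n → ZMod S.Q) (j : S.FrameIdx) :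
    star (S.frameVec j) ⬝ᵥ (S.inst (S.famBT T β) (S.vOf (S.xyv x yb))).phi7d
      = if j.2 = S.mOf T β x j.1 then S.coefOf T β x yb j.1 * ((S.frameNormSq : ℝ) : ℂ) else 0 := by
  have hφ : (S.inst (S.famBT T β) (S.vOf (S.xyv x yb))).phi7d
      = ∑ η : Fin S.n → ZMod S.Q, S.coefOf T β x yb η • S.frameVec (η, S.mOf T β x η) := by
    funext p
    rw [Finset.sum_apply]
    simp_rw [Pi.smul_apply, smul_eq_mul]
    exact S.phi7d_member_apply T β x yb p
  rw [hφ, dotProduct_sum]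
  simp_rw [dotProduct_smul, smul_eq_mul, S.frame_orth h]
  rw [Finset.sum_eq_single_of_mem j.1 (Finset.mem_univ _) fun η _ hη => by
    rw [if_neg (fun hj => hη (congrArg Prod.fst hj).symm), mul_zero]]
  by_cases hm : j.2 = S.mOf T β x j.1
  · have hj : j = (j.1, S.mOf T β x j.1) := Prod.ext rfl hm
    rw [if_pos hj, if_pos hm]
  · have hj : j ≠ (j.1, S.mOf T β x j.1) := fun hj => hm (congrArg Prod.snd hj)
    rw [if_neg hj, if_neg hm, mul_zero]

/-- Weight of outcome `some (η′, m′)` of the frame POVM on a member: `ν/Q²ⁿ·[m′ = m_{β,x}(η′)]` — uniform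
over the `Qⁿ` blocks `η′`, deterministic in `m′`, INDEPENDENT of the unknown tail offsets `ȳ`.
[cite: NielsenChuang2010, §2.2.6 p. 90] -/
theorem frame_weight_some_re (h : S.Admissible) (T : Finset (Fin S.n)) (β : Fin S.n → ZMod S.Q)
    (x : ZMod S.Q) (yb : Fin S.n → ZMod S.Q) (j : S.FrameIdx) :
    ((POVM.ofFrame S.frameVec S.frameNormSq_pos (S.frame_orth h)).weight
        (S.inst (S.famBT T β) (S.vOf (S.xyv x yb))).phi7d (some j)).re
      = if j.2 = S.mOf T β x j.1 then S.frameNormSq / ((S.Q : ℕ) : ℝ) ^ (2 * S.n) else 0 := by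
  rw [POVM.ofFrame_weight_some, Complex.ofReal_re, S.frameVec_dotProduct_member h]
  split_ifs with hm
  · rw [norm_mul, Complex.norm_real, Real.norm_of_nonneg S.frameNormSq_pos.le, S.norm_coefOf, pow_mul]
    have hν : S.frameNormSq ≠ 0 := S.frameNormSq_pos.ne'
    have hQ : ((S.Q : ℕ) : ℝ) ^ S.n ≠ 0 := pow_ne_zero _ (by exact_mod_cast S.Q.ne_zero)
    field_simp
    ring
  · rw [norm_zero, zero_pow two_ne_zero, mul_zero]

/-- The squared norm of a member is `ν/Qⁿ`. [cite: NielsenChuang2010, §2.2.6 p. 90] -/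
theorem star_phi7d_member (h : S.Admissible) (T : Finset (Fin S.n)) (β : Fin S.n → ZMod S.Q)
    (x : ZMod S.Q) (yb : Fin S.n → ZMod S.Q) :
    (star (S.inst (S.famBT T β) (S.vOf (S.xyv x yb))).phi7d
        ⬝ᵥ (S.inst (S.famBT T β) (S.vOf (S.xyv x yb))).phi7d).re = S.frameNormSq / ((S.Q : ℕ) : ℝ) ^ S.n := by
  have hI : (S.inst (S.famBT T β) (S.vOf (S.xyv x yb))).Admissible :=
    (S.inClass_famT h T (U := Finset.univ) (fun t _ => Finset.mem_univ _) β (S.xyv x yb)).2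
  rw [S.star_phi7d_dotProduct_phi7d_inst hI, show (((S.M : ℕ) : ℂ) * (S.D : ℕ)) ^ (S.n + 1)
      * (((S.P : ℕ) : ℂ) * 2 ^ S.n) = (((((S.M : ℕ) : ℝ) * (S.D : ℕ)) ^ (S.n + 1)
      * (((S.P : ℕ) : ℝ) * 2 ^ S.n) : ℝ) : ℂ) by push_cast; ring, Complex.ofReal_re, frameNormSq]
  have hQ : ((S.Q : ℕ) : ℝ) ^ S.n ≠ 0 := pow_ne_zero _ (by exact_mod_cast S.Q.ne_zero)
  field_simp

/-- Weight of outcome `none` of the frame POVM on a member is `0` (members lie in the span of the frame).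
[cite: NielsenChuang2010, §2.2.6 p. 90] -/
theorem frame_weight_none_re (h : S.Admissible) (T : Finset (Fin S.n)) (β : Fin S.n → ZMod S.Q)
    (x : ZMod S.Q) (yb : Fin S.n → ZMod S.Q) :
    ((POVM.ofFrame S.frameVec S.frameNormSq_pos (S.frame_orth h)).weight
        (S.inst (S.famBT T β) (S.vOf (S.xyv x yb))).phi7d none).re = 0 := by
  rw [POVM.ofFrame_weight_none_re]
  -- the squared norm, at the register type of `S`
  have hnorm : ∀ φ : (Fin (S.n + 1) → ZMod S.M) → ℂ, φ = (S.inst (S.famBT T β) (S.vOf (S.xyv x yb))).phi7d →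
      (star φ ⬝ᵥ φ).re = S.frameNormSq / ((S.Q : ℕ) : ℝ) ^ S.n := by
    rintro φ rfl
    exact S.star_phi7d_member h T β x yb
  rw [hnorm _ rfl]
  simp_rw [S.frameVec_dotProduct_member h]
  have hterm : ∀ j : S.FrameIdx, S.frameNormSq⁻¹
      * ‖(if j.2 = S.mOf T β x j.1 then S.coefOf T β x yb j.1 * ((S.frameNormSq : ℝ) : ℂ) else 0 : ℂ)‖ ^ 2
      = if j.2 = S.mOf T β x j.1 then S.frameNormSq / (((S.Q : ℕ) : ℝ) ^ S.n) ^ 2 else 0 := by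
    intro j
    split_ifs with hm
    · rw [norm_mul, Complex.norm_real, Real.norm_of_nonneg S.frameNormSq_pos.le, S.norm_coefOf]
      have hν : S.frameNormSq ≠ 0 := S.frameNormSq_pos.ne'
      have hQ : ((S.Q : ℕ) : ℝ) ^ S.n ≠ 0 := pow_ne_zero _ (by exact_mod_cast S.Q.ne_zero)
      field_simp
    · rw [norm_zero, zero_pow two_ne_zero, mul_zero]
  simp_rw [hterm]
  rw [Fintype.sum_prod_type]
  simp_rw [Finset.sum_ite_eq' Finset.univ, if_pos (Finset.mem_univ _)]
  simp only [Finset.sum_const, Finset.card_univ, Fintype.card_pi, Finset.prod_const, ZMod.card,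
    Fintype.card_fin, nsmul_eq_mul]
  have hQ : ((S.Q : ℕ) : ℝ) ^ S.n ≠ 0 := pow_ne_zero _ (by exact_mod_cast S.Q.ne_zero)
  push_cast
  field_simp
  ring

/-! ### The decoder and the exact success weight on every member -/

/-- `1/2 ∈ ℤ_Q` (`Q` odd). [folklore] -/
noncomputable def half : ZMod S.Q := (2 : ZMod S.Q)⁻¹

/-- `2·(1/2) = 1` in `ℤ_Q` for an admissible (odd) `Q`. [folklore] -/
theorem two_mul_half (h : S.Admissible) : (2 : ZMod S.Q) * S.half = 1 := by
  unfold half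
  have hu : IsUnit (2 : ZMod S.Q) := by
    have h2 := (ZMod.isUnit_iff_coprime 2 S.Q).2 (Nat.coprime_two_left.2 h.odd_Q)
    exact_mod_cast h2
  exact ZMod.mul_inv_of_unit _ hu

/-- The label of head offset `x`: `ℓ(x) := v′₀ + L·x (mod N)` — the Step-9 datum of every member with head
offset `x` (`step9Needs_fam`). [cite: ChenQuantumLattice2024, §3.5.9 p. 37] -/
def label (x : ZMod S.Q) : ZMod S.N := (((S.v' 0 + S.L * x.val : ℤ)) : ZMod S.N)

/-- The decoder's head-offset estimate from outcome `((η, m), β′)`: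
`x̂ := −m/2 − σ₀(η) − Σ_{t ∈ T} η_t β′_t`. [folklore] -/
noncomputable def xhat (T : Finset (Fin S.n)) (η : Fin S.n → ZMod S.Q) (m : ZMod S.Q)
    (β' : Fin S.n → ZMod S.Q) : ZMod S.Q :=
  -(S.half * m) - S.sig (fun t => S.b t.succ / (2 * (S.p₁ : ℤ))) η - ∑ t ∈ T, η t * β' t

/-- **THE DECODER** of the frame measurement: on outcome `(some (η, m), β′)` answer `ℓ(x̂(η, m, β′))`
(solve `m = −2(x + σ₀(η) + Σ_T η_tβ_t)` for `x` with the guessed dummies `β′`); on `(none, β′)` answer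
anything (that outcome has weight `0` on the class). [folklore] -/
noncomputable def frameDec (T : Finset (Fin S.n)) : Option S.FrameIdx × (Fin S.n → ZMod S.Q) → ZMod S.N
  | (none, _) => 0
  | (some j, β') => S.label (S.xhat T j.1 j.2 β')

/-- On the true block datum the estimate is off by exactly the dummy mismatch:
`x̂(η, m_{β,x}(η), β′) = x + Σ_{t∈T} η_t(β_t − β′_t)`. [folklore] -/
theorem xhat_mOf (h : S.Admissible) (T : Finset (Fin S.n)) (β : Fin S.n → ZMod S.Q) (x : ZMod S.Q)
    (η β' : Fin S.n → ZMod S.Q) :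
    S.xhat T η (S.mOf T β x η) β' = x + ∑ t ∈ T, η t * (β t - β' t) := by
  unfold xhat mOf
  rw [S.sig_BfamT]
  simp only [mul_sub, Finset.sum_sub_distrib]
  linear_combination (x + S.sig (fun t => S.b t.succ / (2 * (S.p₁ : ℤ))) η + ∑ t ∈ T, η t * β t)
    * S.two_mul_half h

/-- **Decoder correctness criterion:** on the member `(β, x, ȳ)`, outcome `(some (η, m_{β,x}(η)), β′)` is
decoded correctly iff `Σ_{t∈T} η_t(β_t − β′_t) = 0` (the `Q` labels are distinct, `label_inj`).
[cite: ChenQuantumLattice2024, Cond. C.3 p. 18, §3.5.9 p. 37] -/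
theorem frameDec_correct_iff (h : S.Admissible) (T : Finset (Fin S.n)) (β : Fin S.n → ZMod S.Q)
    (x : ZMod S.Q) (yb η β' : Fin S.n → ZMod S.Q) :
    S.frameDec T (some (η, S.mOf T β x η), β') = (S.inst (S.famBT T β) (S.vOf (S.xyv x yb))).step9Needs
      ↔ ∑ t ∈ T, η t * (β t - β' t) = 0 := by
  rw [S.step9Needs_fam]
  show S.label (S.xhat T η (S.mOf T β x η) β') = _ ↔ _
  rw [S.xhat_mOf h]
  unfold label
  constructor
  · intro hl
    have hx := S.label_inj h hl
    exact add_eq_left.1 hx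
  · intro h0
    rw [h0, add_zero]

/-- **The correctly decoded outcomes are counted by `pairsCountT`:**
`#{((η, m), β′) : m = m_{β,x}(η), decoded correctly} = pairsCountT(Q, T)` (`(η, δ) ↦ ((η, m(η)), β − δ)`).
[folklore] -/
theorem card_correct_eq_pairsCountT (h : S.Admissible) (T : Finset (Fin S.n)) (β : Fin S.n → ZMod S.Q)
    (x : ZMod S.Q) (yb : Fin S.n → ZMod S.Q) :
    (Finset.univ.filter fun q : S.FrameIdx × (Fin S.n → ZMod S.Q) =>
        S.frameDec T (some q.1, q.2) = (S.inst (S.famBT T β) (S.vOf (S.xyv x yb))).step9Needs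
          ∧ q.1.2 = S.mOf T β x q.1.1).card = pairsCountT (S.Q : ℕ) T := by
  unfold pairsCountT
  symm
  refine Finset.card_nbij'
    (fun p : (Fin S.n → ZMod S.Q) × (Fin S.n → ZMod S.Q) => ((p.1, S.mOf T β x p.1), β - p.2))
    (fun q => (q.1.1, β - q.2)) (fun p hp => ?_) (fun q hq => ?_) (fun p _ => ?_) (fun q hq => ?_)
  · simp only [Finset.mem_coe, Finset.mem_filter, Finset.mem_univ, true_and, and_true] at hp ⊢
    rw [S.frameDec_correct_iff h]
    simpa only [Pi.sub_apply, sub_sub_cancel] using hp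
  · simp only [Finset.mem_coe, Finset.mem_filter, Finset.mem_univ, true_and] at hq ⊢
    have hq1 : q.1 = (q.1.1, S.mOf T β x q.1.1) := Prod.ext rfl hq.2
    have hdec := hq.1
    rw [hq1, S.frameDec_correct_iff h] at hdec
    simpa only [Pi.sub_apply, sub_sub_cancel] using hdec
  · simp only [sub_sub_cancel]
  · simp only [Finset.mem_coe, Finset.mem_filter, Finset.mem_univ, true_and] at hq
    have hq1 : q.1 = (q.1.1, S.mOf T β x q.1.1) := Prod.ext rfl hq.2
    simp only [sub_sub_cancel]
    exact Prod.ext hq1.symm rfl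

/-- **READ-OUT BOUND ATTAINED (tightness of (S) on the dummy family, exact).**  For EVERY odd admissible `Q`,
every dummy set `T ⊆ {1,…,n}` and EVERY member `(β, x, ȳ)` of the averaging family of
`step9Needs_readout_le_dummies` (slopes `(−1, 2p₁B_T(β))`, offset `v′ + L·(x, ȳ)`), the frame measurement
`framePOVM` with the decoder `frameDec T` outputs the Step-9 datum `v′₀ + Lx (mod D²P)` with weight EXACTLY
`pairsCountT(Q,T)/Q^{2n} · ⟨φ7.d|φ7.d⟩` — the upper bound of (S) `step9Needs_readout_le_dummies`, on every
member, not just on average.  Mechanism: `|φ7.d⟩ = Σ_η coef(η) W_{η, m(η)}` with `|coef| = Q⁻ⁿ` and the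
`W`'s orthogonal, so the frame POVM returns a uniformly random block `η` together with its exact head datum
`m(η) = −2(x + σ₀(η) + Σ_T η_tβ_t)`; guessing the dummies `β′` uniformly and solving for `x` is right iff
`Σ_T η_t(β − β′)_t = 0`, and `#{(η, β′)} = pairsCountT(Q,T)`.  Hence the minimax value of the read-out
problem on this family IS `pairsCountT(Q,T)/Q^{2n}` (`= 1/Q + (1 − 1/Q)/Q^{#T}` for prime `Q`), strictly
above the blind-guess value `1/Q` of (S) `blindGuess_weight_eq`; the exact optimum over the whole class
`InClass U` (all offsets `v′`) is NOT claimed.  Value: a kernel-checked THEOREM about the withdrawn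
algorithm (tightness of the programme's own bound) — not summit progress, no cryptanalytic claim.
[cite: ChenQuantumLattice2024, §3.5.8 pp. 33–34, §3.5.9 p. 37; NielsenChuang2010, §2.2.6 p. 90] -/
theorem step9Needs_readout_attained (h : S.Admissible) (T : Finset (Fin S.n)) (β : Fin S.n → ZMod S.Q)
    (x : ZMod S.Q) (yb : Fin S.n → ZMod S.Q) :
    ∑ k ∈ Finset.univ.filter
        (fun k => S.frameDec T k = (S.inst (S.famBT T β) (S.vOf (S.xyv x yb))).step9Needs),
        ((S.framePOVM h).weight (S.inst (S.famBT T β) (S.vOf (S.xyv x yb))).phi7d k).re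
      = (pairsCountT (S.Q : ℕ) T : ℝ) / ((S.Q : ℕ) : ℝ) ^ (2 * S.n)
          * (star (S.inst (S.famBT T β) (S.vOf (S.xyv x yb))).phi7d
              ⬝ᵥ (S.inst (S.famBT T β) (S.vOf (S.xyv x yb))).phi7d).re := by
  classical
  set N₉ := (S.inst (S.famBT T β) (S.vOf (S.xyv x yb))).step9Needs with hN₉
  have hcard : (Fintype.card (Fin S.n → ZMod S.Q) : ℝ) = ((S.Q : ℕ) : ℝ) ^ S.n := by
    rw [Fintype.card_pi, Finset.prod_const, ZMod.card, Finset.card_univ, Fintype.card_fin]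
    push_cast
    rfl
  rw [Finset.sum_filter, Fintype.sum_prod_type, Fintype.sum_option]
  simp only [framePOVM, POVM.withCoin_weight_re, S.frame_weight_none_re h, S.frame_weight_some_re h,
    mul_zero, ite_self, Finset.sum_const_zero, zero_add, hcard]
  -- collect the two conditions
  have hite : ∀ (j : S.FrameIdx) (β' : Fin S.n → ZMod S.Q),
      (if S.frameDec T (some j, β') = N₉ then
          (((S.Q : ℕ) : ℝ) ^ S.n)⁻¹ * (if j.2 = S.mOf T β x j.1 then
            S.frameNormSq / ((S.Q : ℕ) : ℝ) ^ (2 * S.n) else 0) else 0)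
        = if S.frameDec T (some j, β') = N₉ ∧ j.2 = S.mOf T β x j.1 then
            (((S.Q : ℕ) : ℝ) ^ S.n)⁻¹ * (S.frameNormSq / ((S.Q : ℕ) : ℝ) ^ (2 * S.n)) else 0 := by
    intro j β'
    split_ifs <;> simp_all
  simp_rw [hite]
  rw [← Fintype.sum_prod_type' (f := fun (j : S.FrameIdx) (β' : Fin S.n → ZMod S.Q) =>
      if S.frameDec T (some j, β') = N₉ ∧ j.2 = S.mOf T β x j.1 then
        (((S.Q : ℕ) : ℝ) ^ S.n)⁻¹ * (S.frameNormSq / ((S.Q : ℕ) : ℝ) ^ (2 * S.n)) else 0),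
    ← Finset.sum_filter, Finset.sum_const, S.card_correct_eq_pairsCountT h, nsmul_eq_mul,
    S.star_phi7d_member h]
  have hQ : ((S.Q : ℕ) : ℝ) ≠ 0 := by exact_mod_cast S.Q.ne_zero
  field_simp

/-! ### The attained value is strictly above the blind-guess value `1/Q` -/

/-- Every kernel `{δ : Σ_{t∈T} η_tδ_t = 0}` has at least `Q^{n−1}` elements: the `Q` fibres of
`δ ↦ Σ_T η_tδ_t` cover `ℤ_Qⁿ` and each has at most `kerCountT` elements. [folklore] -/
theorem pow_le_mul_kerCountT {Q : ℕ} [NeZero Q] (hQ : Odd Q) {n : ℕ} (T : Finset (Fin n))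
    (η : Fin n → ZMod Q) : Q ^ n ≤ Q * kerCountT Q T η := by
  classical
  have h := Finset.card_eq_sum_card_fiberwise (s := (Finset.univ : Finset (Fin n → ZMod Q)))
    (t := (Finset.univ : Finset (ZMod Q)))
    (f := fun β : Fin n → ZMod Q => -2 * ((0 : ZMod Q) + ((0 : ZMod Q) + ∑ t ∈ T, η t * β t)))
    (fun _ _ => Finset.mem_univ _)
  calc Q ^ n = (Finset.univ : Finset (Fin n → ZMod Q)).card := by
        rw [Finset.card_univ, Fintype.card_pi, Finset.prod_const, ZMod.card, Finset.card_univ, Fintype.card_fin]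
    _ = _ := h
    _ ≤ ∑ _m : ZMod Q, kerCountT Q T η :=
        Finset.sum_le_sum fun m _ => card_fibre_le_kerCountT hQ T 0 0 η m
    _ = Q * kerCountT Q T η := by rw [Finset.sum_const, Finset.card_univ, ZMod.card, smul_eq_mul]

/-- `kerCountT Q T 0 = Qⁿ`. [folklore] -/
theorem kerCountT_zero (Q : ℕ) [NeZero Q] {n : ℕ} (T : Finset (Fin n)) :
    kerCountT Q T (0 : Fin n → ZMod Q) = Q ^ n := by
  unfold kerCountT
  rw [Finset.filter_true_of_mem fun δ _ => by simp only [Pi.zero_apply, zero_mul, Finset.sum_const_zero],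
    Finset.card_univ, Fintype.card_pi, Finset.prod_const, ZMod.card, Finset.card_univ, Fintype.card_fin]

/-- **`pairsCountT(Q,T)/Q^{2n} > 1/Q`:** `Q^{2n} < Q·pairsCountT(Q,T)` for odd `Q > 1`
(`Q·pairsCountT ≥ Q·Qⁿ + (Qⁿ − 1)·Qⁿ`). [folklore] -/
theorem pow_lt_mul_pairsCountT {Q : ℕ} [NeZero Q] (hQ : Odd Q) (h1 : 1 < Q) {n : ℕ} (T : Finset (Fin n)) :
    Q ^ (2 * n) < Q * pairsCountT Q T := by
  classical
  rw [pairsCountT_eq_sum_kerCountT, Finset.mul_sum,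
    ← Finset.add_sum_erase _ _ (Finset.mem_univ (0 : Fin n → ZMod Q)), kerCountT_zero]
  have hrest : (Finset.univ.erase (0 : Fin n → ZMod Q)).card * Q ^ n
      ≤ ∑ η ∈ Finset.univ.erase (0 : Fin n → ZMod Q), Q * kerCountT Q T η := by
    rw [← smul_eq_mul, ← Finset.sum_const]
    exact Finset.sum_le_sum fun η _ => pow_le_mul_kerCountT hQ T η
  have hcard : (Finset.univ.erase (0 : Fin n → ZMod Q)).card = Q ^ n - 1 := by
    rw [Finset.card_erase_of_mem (Finset.mem_univ _), Finset.card_univ, Fintype.card_pi, Finset.prod_const,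
      ZMod.card, Finset.card_univ, Fintype.card_fin]
  rw [hcard] at hrest
  have hQn : 1 ≤ Q ^ n := Nat.one_le_pow _ _ (by omega)
  have hlt : 1 * Q ^ n < Q * Q ^ n := Nat.mul_lt_mul_of_pos_right h1 (by omega)
  calc Q ^ (2 * n) = 1 * Q ^ n + (Q ^ n - 1) * Q ^ n := by
        rw [← add_mul, Nat.add_sub_cancel' hQn, two_mul, pow_add]
    _ < Q * Q ^ n + (Q ^ n - 1) * Q ^ n := Nat.add_lt_add_right hlt _
    _ ≤ Q * Q ^ n + ∑ η ∈ Finset.univ.erase (0 : Fin n → ZMod Q), Q * kerCountT Q T η :=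
        Nat.add_le_add_left hrest _

/-- Real form: `1/Q < pairsCountT(Q,T)/Q^{2n}` for odd `Q > 1`. [folklore] -/
theorem inv_lt_pairsCountT_div {Q : ℕ} [NeZero Q] (hQ : Odd Q) (h1 : 1 < Q) {n : ℕ} (T : Finset (Fin n)) :
    1 / (Q : ℝ) < (pairsCountT Q T : ℝ) / (Q : ℝ) ^ (2 * n) := by
  have hQ0 : (0 : ℝ) < Q := by exact_mod_cast (zero_lt_one.trans h1)
  have h := pow_lt_mul_pairsCountT hQ h1 T
  have h' : ((Q : ℝ)) ^ (2 * n) < (Q : ℝ) * pairsCountT Q T := by exact_mod_cast h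
  rw [div_lt_div_iff₀ hQ0 (pow_pos hQ0 _), one_mul]
  linarith

/-- **THE FRAME MEASUREMENT STRICTLY BEATS BLIND GUESSING ON EVERY MEMBER:** on every member of every dummy
family the success weight `pairsCountT(Q,T)/Q^{2n}·⟨φ7.d|φ7.d⟩` of `framePOVM` + `frameDec T` exceeds the
blind-guess weight `⟨φ7.d|φ7.d⟩/Q` of (S) `blindGuess_weight_eq` (which is exact on every admissible
instance).  So on each family the two sides of (S)'s order are DIFFERENT numbers and the upper one is the
truth; the optimum over the whole class is NOT claimed. [cite: NielsenChuang2010, §2.2.6 p. 90] -/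
theorem blindGuess_lt_readout_attained (h : S.Admissible) (T : Finset (Fin S.n)) (β : Fin S.n → ZMod S.Q)
    (x : ZMod S.Q) (yb : Fin S.n → ZMod S.Q) :
    (1 / ((S.Q : ℕ) : ℝ)) * (star (S.inst (S.famBT T β) (S.vOf (S.xyv x yb))).phi7d
        ⬝ᵥ (S.inst (S.famBT T β) (S.vOf (S.xyv x yb))).phi7d).re
      < ∑ k ∈ Finset.univ.filter
          (fun k => S.frameDec T k = (S.inst (S.famBT T β) (S.vOf (S.xyv x yb))).step9Needs),
          ((S.framePOVM h).weight (S.inst (S.famBT T β) (S.vOf (S.xyv x yb))).phi7d k).re := by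
  rw [S.step9Needs_readout_attained h]
  have hn0 : 0 < (star (S.inst (S.famBT T β) (S.vOf (S.xyv x yb))).phi7d
      ⬝ᵥ (S.inst (S.famBT T β) (S.vOf (S.xyv x yb))).phi7d).re := by
    rw [S.star_phi7d_member h]
    exact div_pos S.frameNormSq_pos (pow_pos (by exact_mod_cast S.Q.pos) _)
  exact mul_lt_mul_of_pos_right (inv_lt_pairsCountT_div h.odd_Q (by have := h.three_le_Q; omega) T) hn0

/-! ### The exact count for a prime `Q`: `pairsCountT(Q,T)/Q^{2n} = 1/Q + (1 − 1/Q)/Q^{#T}` -/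

/-- If `η` vanishes on `T` the kernel is all of `ℤ_Qⁿ`: `kerCountT Q T η = Qⁿ`. [folklore] -/
theorem kerCountT_of_forall_eq_zero (Q : ℕ) [NeZero Q] {n : ℕ} (T : Finset (Fin n))
    {η : Fin n → ZMod Q} (hη : ∀ t ∈ T, η t = 0) : kerCountT Q T η = Q ^ n := by
  unfold kerCountT
  rw [Finset.filter_true_of_mem fun δ _ => Finset.sum_eq_zero fun t ht => by rw [hη t ht, zero_mul],
    Finset.card_univ, Fintype.card_pi, Finset.prod_const, ZMod.card, Finset.card_univ, Fintype.card_fin]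

/-- With a unit coefficient on `T` (`Q` odd) the kernel has EXACTLY `Q^{n−1}` points: `Q·kerCountT = Qⁿ`
((S) `kerCountT_le_of_isUnit` and `pow_le_mul_kerCountT`). [folklore] -/
theorem mul_kerCountT_of_isUnit {Q : ℕ} [NeZero Q] (hQ : Odd Q) {n : ℕ} {T : Finset (Fin n)}
    {η : Fin n → ZMod Q} {t₀ : Fin n} (ht₀ : t₀ ∈ T) (hu : IsUnit (η t₀)) :
    Q * kerCountT Q T η = Q ^ n := by
  refine le_antisymm ?_ (pow_le_mul_kerCountT hQ T η)
  calc Q * kerCountT Q T η ≤ Q * Q ^ (n - 1) := Nat.mul_le_mul_left _ (kerCountT_le_of_isUnit Q ht₀ hu)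
    _ = Q ^ n := by rw [← pow_succ', Nat.sub_add_cancel (Nat.one_le_of_lt t₀.pos)]

/-- **Exact count for a prime `Q`:** `Q·pairsCountT(Q,T) = Qⁿ·(Qⁿ + (Q − 1)·Q^{n−#T})` — (S)'s counting
bound `mul_pairsCountT_le` is an EQUALITY when every nonzero residue is a unit: the `Q^{n−#T}` slope vectors
vanishing on `T` have kernel `ℤ_Qⁿ`, every other one has a unit on `T` and a kernel of `Q^{n−1}` points.
[folklore] -/
theorem mul_pairsCountT_eq_prime {Q : ℕ} [NeZero Q] (hP : Q.Prime) (hQ : Odd Q) {n : ℕ}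
    (T : Finset (Fin n)) : Q * pairsCountT Q T = Q ^ n * (Q ^ n + (Q - 1) * Q ^ (n - T.card)) := by
  classical
  haveI : Fact Q.Prime := ⟨hP⟩
  rw [← nonGenericCount_prime T, pairsCountT_eq_sum_kerCountT, Finset.mul_sum]
  have hpt : ∀ η : Fin n → ZMod Q,
      Q * kerCountT Q T η = if (∀ t ∈ T, ¬ IsUnit (η t)) then Q ^ (n + 1) else Q ^ n := by
    intro η
    split_ifs with hη
    · have hz : ∀ t ∈ T, η t = 0 := fun t ht => by
        by_contra hne
        exact hη t ht (isUnit_iff_ne_zero.2 hne)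
      rw [kerCountT_of_forall_eq_zero Q T hz, pow_succ']
    · push Not at hη
      obtain ⟨t₀, ht₀, hu⟩ := hη
      exact mul_kerCountT_of_isUnit hQ ht₀ hu
  rw [Finset.sum_congr rfl fun η _ => hpt η, Finset.sum_ite, Finset.sum_const, Finset.sum_const,
    smul_eq_mul, smul_eq_mul]
  have hc := Finset.card_filter_add_card_filter_not (s := (Finset.univ : Finset (Fin n → ZMod Q)))
    (fun η : Fin n → ZMod Q => ∀ t ∈ T, ¬ IsUnit (η t))
  rw [Finset.card_univ, Fintype.card_pi, Finset.prod_const, ZMod.card, Finset.card_univ, Fintype.card_fin]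
    at hc
  have hNG : (Finset.univ.filter fun η : Fin n → ZMod Q => ∀ t ∈ T, ¬ IsUnit (η t)).card
      = nonGenericCount Q n T := rfl
  rw [hNG] at hc ⊢
  set A := nonGenericCount Q n T
  set B := (Finset.univ.filter fun η : Fin n → ZMod Q => ¬ ∀ t ∈ T, ¬ IsUnit (η t)).card
  have hQ1 : 1 ≤ Q := Nat.pos_of_ne_zero (NeZero.ne Q)
  zify [hQ1] at hc ⊢
  have hB : (B : ℤ) = (Q : ℤ) ^ n - A := by linarith
  rw [hB, pow_succ]
  ring

/-- Real form, prime `Q`: `pairsCountT(Q,T)/Q^{2n} = 1/Q + (1 − 1/Q)·(1/Q^{#T})` — the constant of (S)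
`Shape.step9Needs_readout_le_dummies_prime` is the family value itself, not only a bound for it. [folklore] -/
theorem pairsCountT_div_eq_prime {Q : ℕ} [NeZero Q] (hP : Q.Prime) (hQ : Odd Q) {n : ℕ}
    (T : Finset (Fin n)) :
    (pairsCountT Q T : ℝ) / (Q : ℝ) ^ (2 * n) = 1 / (Q : ℝ) + (1 - 1 / (Q : ℝ)) * (1 / (Q : ℝ) ^ T.card) := by
  have hQ0 : (Q : ℝ) ≠ 0 := by exact_mod_cast NeZero.ne Q
  have hQ1 : 1 ≤ Q := Nat.pos_of_ne_zero (NeZero.ne Q)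
  have hT : T.card ≤ n := by simpa using Finset.card_le_univ T
  have h := mul_pairsCountT_eq_prime hP hQ T
  have h' : (Q : ℝ) * (pairsCountT Q T : ℝ) = (Q : ℝ) ^ n * ((Q : ℝ) ^ n + ((Q : ℝ) - 1) * (Q : ℝ) ^ (n - T.card)) := by
    have := congrArg (Nat.cast (R := ℝ)) h
    push_cast [Nat.cast_sub hQ1] at this
    exact this
  have hn : (Q : ℝ) ^ n = (Q : ℝ) ^ (n - T.card) * (Q : ℝ) ^ T.card := by
    rw [← pow_add, Nat.sub_add_cancel hT]
  have h2n : (Q : ℝ) ^ (2 * n) = (Q : ℝ) ^ n * (Q : ℝ) ^ n := by rw [two_mul, pow_add]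
  have hP' : (pairsCountT Q T : ℝ)
      = (Q : ℝ) ^ n * ((Q : ℝ) ^ n + ((Q : ℝ) - 1) * (Q : ℝ) ^ (n - T.card)) / Q := by
    rw [eq_div_iff hQ0, mul_comm, h']
  rw [hP', h2n, hn]
  have ha : (Q : ℝ) ^ (n - T.card) ≠ 0 := pow_ne_zero _ hQ0
  have hb : (Q : ℝ) ^ T.card ≠ 0 := pow_ne_zero _ hQ0
  field_simp

/-- **PRIME `Q`: THE FAMILY VALUE IN CLOSED FORM.**  On every member of the dummy family the frame
measurement succeeds with weight EXACTLY `(1/Q + (1 − 1/Q)/Q^{#T})·⟨φ7.d|φ7.d⟩` — the constant of (S)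
`Shape.step9Needs_readout_le_dummies_prime`, which is therefore attained and is the minimax value of the
single-copy read-out problem on `F_T` for prime `Q`.  (Class optimum NOT claimed.)
[cite: ChenQuantumLattice2024, §3.5.8 pp. 33–34, §3.5.9 p. 37; NielsenChuang2010, §2.2.6 p. 90] -/
theorem step9Needs_readout_attained_prime (h : S.Admissible) (hQ : (S.Q : ℕ).Prime) (T : Finset (Fin S.n))
    (β : Fin S.n → ZMod S.Q) (x : ZMod S.Q) (yb : Fin S.n → ZMod S.Q) :
    ∑ k ∈ Finset.univ.filter
        (fun k => S.frameDec T k = (S.inst (S.famBT T β) (S.vOf (S.xyv x yb))).step9Needs),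
        ((S.framePOVM h).weight (S.inst (S.famBT T β) (S.vOf (S.xyv x yb))).phi7d k).re
      = (1 / ((S.Q : ℕ) : ℝ) + (1 - 1 / ((S.Q : ℕ) : ℝ)) * (1 / ((S.Q : ℕ) : ℝ) ^ T.card))
          * (star (S.inst (S.famBT T β) (S.vOf (S.xyv x yb))).phi7d
              ⬝ᵥ (S.inst (S.famBT T β) (S.vOf (S.xyv x yb))).phi7d).re := by
  rw [S.step9Needs_readout_attained h T β x yb, pairsCountT_div_eq_prime hQ h.odd_Q T]

/-- **THE VALUE OF THE READ-OUT PROBLEM ON THE DUMMY FAMILY (both sides, packaged).**  For every dummy set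
`T` with `T+1 ⊆ U`: (i) ((S), imported) for EVERY POVM `E` and EVERY decoder `dec` some instance of the class
`InClass U` has success weight `≤ pairsCountT(Q,T)/Q^{2n}·⟨φ7.d|φ7.d⟩` — and (S)'s witness is a member of
the family `F_T = {(famBT T β, v′ + L·(x, ȳ))}`; (ii) (this file) EVERY member of `F_T` lies in the class and
the frame measurement `framePOVM` + `frameDec T` succeeds on it with weight EXACTLY that bound.  So no
statement of (S)'s form restricted to `F_T` holds with a smaller constant: the bound is the minimax value
of the single-copy read-out problem on `F_T`.  The value on the whole class is NOT claimed.
[cite: ChenQuantumLattice2024, §3.5.8 pp. 33–34, §3.5.9 p. 37; NielsenChuang2010, §2.2.6 p. 90] -/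
theorem step9Needs_readout_value_family (h : S.Admissible) (T : Finset (Fin S.n))
    {U : Finset (Fin (S.n + 1))} (hU : ∀ t ∈ T, t.succ ∈ U) :
    (∀ {κ : Type*} [Fintype κ] [DecidableEq κ] (E : POVM (Fin (S.n + 1) → ZMod S.M) κ) (dec : κ → ZMod S.N),
      ∃ b₂ v₂ : Fin (S.n + 1) → ℤ, S.InClass U b₂ v₂ ∧
        (∑ k ∈ Finset.univ.filter (fun k => dec k = (S.inst b₂ v₂).step9Needs),
            (E.weight (S.inst b₂ v₂).phi7d k).re)
          ≤ (pairsCountT (S.Q : ℕ) T : ℝ) / ((S.Q : ℕ) : ℝ) ^ (2 * S.n)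
              * (star (S.inst b₂ v₂).phi7d ⬝ᵥ (S.inst b₂ v₂).phi7d).re) ∧
    (∀ (β : Fin S.n → ZMod S.Q) (x : ZMod S.Q) (yb : Fin S.n → ZMod S.Q),
      S.InClass U (S.famBT T β) (S.vOf (S.xyv x yb)) ∧
        ∑ k ∈ Finset.univ.filter
            (fun k => S.frameDec T k = (S.inst (S.famBT T β) (S.vOf (S.xyv x yb))).step9Needs),
            ((S.framePOVM h).weight (S.inst (S.famBT T β) (S.vOf (S.xyv x yb))).phi7d k).re
          = (pairsCountT (S.Q : ℕ) T : ℝ) / ((S.Q : ℕ) : ℝ) ^ (2 * S.n)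
              * (star (S.inst (S.famBT T β) (S.vOf (S.xyv x yb))).phi7d
                  ⬝ᵥ (S.inst (S.famBT T β) (S.vOf (S.xyv x yb))).phi7d).re) :=
  ⟨fun E dec => S.step9Needs_readout_le_dummies h T hU E dec,
    fun β x yb => ⟨S.inClass_famT h T hU β _, S.step9Needs_readout_attained h T β x yb⟩⟩

end Shape

end Literature.Computability.Cryptography.Chen2024
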